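import Summits.AnomalousDissipation.AnomalousDissipation.Theorems.MomentParityQuarticGateSlater

/-!
# Far atoms and composite laws (helpers for the order-4 surgery `stub_surgery` of
`MomentParity.QuarticGate`, line `recession-cone`, stmt-AnomalousDissipation-11464)

The surgery law is `μ = (1 − w) μ₁ + Σₗ qₗ (δ_{R vₗ} + δ_{−R vₗ})` on `H`. This file records the
bookkeeping for such COMPOSITE laws and for SCALED level-`N` fields:

* `level_smul`, `pairing_smul_left`, `coords_smul` — `t • u` is level-`N` with coordinates `t • x`;
* `ae_finsetSum_measure`, `ae_composite`, `isProbabilityMeasure_composite`, `integrable_composite`,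
  `integral_composite` — a.e. properties, total mass, integrability and integrals against
  `a • μ₁ + Σₗ qₗ (δ_{Aₗ} + δ_{Bₗ})`;
* `row_eq_add_of_sub` — the row of a polynomial test is additive in the polynomial;
* `integrable_of_eval_of_level` — an observable that is a coordinate polynomial of degree `≤ 4` on
  level-`N` fields is integrable against a level-`N`-carried finite law with `∫ ‖u‖⁴ < ∞`.
-/

namespace Summit.AnomalousDissipation.AnomalousDissipation.Theorems.MomentParityQuarticGate

open MeasureTheory Filter MvPolynomial
open scoped InnerProductSpace RealInnerProductSpace ENNReal
open Literature.Analysis.FunctionSpaces Literature.Analysis.FluidPDE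
open Summit.AnomalousDissipation.AnomalousDissipation.Theses.MomentParity

set_option linter.dupNamespace false

variable {N n : ℕ} {b : Fin n → UnitAddTorus (Fin 3) → EuclideanSpace ℝ (Fin 3)}

/-! ## Scaled level-`N` fields -/

/-- A real multiple of a level-`N` field is level-`N`. [folklore] -/
theorem level_smul :
    ∀ {N : ℕ} (t : ℝ) {u : Torus.energySpace (Fin 3)},
      (∀ k ∉ (Torus.freqBall N).erase (0 : Fin 3 → ℤ),
        UnitAddTorus.mFourierCoeff (EuclideanSpace.complexify ∘
          (u.1 : UnitAddTorus (Fin 3) → EuclideanSpace ℝ (Fin 3))) k = 0) →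
      ∀ k ∉ (Torus.freqBall N).erase (0 : Fin 3 → ℤ),
        UnitAddTorus.mFourierCoeff (EuclideanSpace.complexify ∘
          ((t • u).1 : UnitAddTorus (Fin 3) → EuclideanSpace ℝ (Fin 3))) k = 0 := by
  intro N t u hu k hk
  have hae : ((t • u).1 : UnitAddTorus (Fin 3) → EuclideanSpace ℝ (Fin 3)) =ᵐ[volume]
      fun x => t • (u.1 : UnitAddTorus (Fin 3) → EuclideanSpace ℝ (Fin 3)) x := by
    rw [Submodule.coe_smul]
    exact Lp.coeFn_smul t u.1
  rw [Torus.mFourierCoeff_congr_ae (hae.fun_comp EuclideanSpace.complexify) k,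
    mFourierCoeff_complexify_smul, hu k hk, smul_zero]

/-- The pairing is linear in the `L²` class: `(t u, g) = t (u, g)`. [folklore] -/
theorem pairing_smul_left (t : ℝ) (u : Torus.energySpace (Fin 3))
    {g : UnitAddTorus (Fin 3) → EuclideanSpace ℝ (Fin 3)} (hg : MemLp g 2 volume) :
    Torus.pairing (t • u).1 g = t * Torus.pairing u.1 g := by
  rw [Submodule.coe_smul, Torus.pairing_eq_inner hg, Torus.pairing_eq_inner hg, real_inner_smul_left]

/-- Coordinates of a scaled field: `((t u, bᵢ))ᵢ = t • ((u, bᵢ))ᵢ`. [folklore] -/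
theorem coords_smul
    (hb : ∀ i, Torus.IsSmooth (b i) ∧ Torus.IsDivFree (b i) ∧ Torus.HasZeroMean (b i) ∧
      ∀ k ∉ (Torus.freqBall N).erase (0 : Fin 3 → ℤ),
        UnitAddTorus.mFourierCoeff (EuclideanSpace.complexify ∘ (b i)) k = 0)
    (t : ℝ) (u : Torus.energySpace (Fin 3)) :
    (fun i => Torus.pairing (t • u).1 (b i)) = t • fun i => Torus.pairing u.1 (b i) := by
  funext i
  rw [Pi.smul_apply, smul_eq_mul, pairing_smul_left t u ((hb i).1.memLp 2)]

/-! ## Composite laws `a • μ₁ + Σₗ qₗ (δ_{Aₗ} + δ_{Bₗ})` -/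

/-- An a.e. property of each summand is an a.e. property of a finite sum of measures. [folklore] -/
theorem ae_finsetSum_measure {α ι : Type*} {m : MeasurableSpace α} (s : Finset ι)
    (μ : ι → Measure α) {p : α → Prop} (h : ∀ i ∈ s, ∀ᵐ x ∂μ i, p x) :
    ∀ᵐ x ∂(∑ i ∈ s, μ i), p x := by
  classical
  induction s using Finset.induction_on with
  | empty => simp
  | insert a s ha ih =>
    rw [Finset.sum_insert ha, ae_add_measure_iff]
    exact ⟨h a (Finset.mem_insert_self a s), ih fun i hi => h i (Finset.mem_insert_of_mem hi)⟩

/-- A property holding `μ₁`-a.e. and at all atoms holds a.e. for the composite law. [folklore] -/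
theorem ae_composite {M : ℕ} {μ₁ : Measure (Torus.energySpace (Fin 3))} {a : ℝ≥0∞}
    {q : Fin M → ℝ≥0∞} {A B : Fin M → Torus.energySpace (Fin 3)}
    {p : Torus.energySpace (Fin 3) → Prop} (h₁ : ∀ᵐ u ∂μ₁, p u) (hA : ∀ l, p (A l))
    (hB : ∀ l, p (B l)) :
    ∀ᵐ u ∂(a • μ₁ + ∑ l, q l • (Measure.dirac (A l) + Measure.dirac (B l))), p u := by
  haveI : MeasurableSingletonClass (Torus.energySpace (Fin 3)) :=
    OpensMeasurableSpace.toMeasurableSingletonClass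
  refine ae_add_measure_iff.2 ⟨Measure.ae_smul_measure h₁ _, ae_finsetSum_measure _ _ fun l _ =>
    Measure.ae_smul_measure (ae_add_measure_iff.2 ⟨?_, ?_⟩) _⟩
  · show ∀ᶠ u in ae (Measure.dirac (A l)), p u
    rw [ae_dirac_eq]
    exact Filter.eventually_pure.2 (hA l)
  · show ∀ᶠ u in ae (Measure.dirac (B l)), p u
    rw [ae_dirac_eq]
    exact Filter.eventually_pure.2 (hB l)

/-- Total mass of the composite law: it is a probability measure when `a + Σₗ 2qₗ = 1`. [folklore] -/
theorem isProbabilityMeasure_composite {M : ℕ} (μ₁ : Measure (Torus.energySpace (Fin 3)))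
    [IsProbabilityMeasure μ₁] {a : ℝ} {q : Fin M → ℝ} (ha : 0 ≤ a) (hq : ∀ l, 0 ≤ q l)
    (hsum : a + ∑ l, 2 * q l = 1) (A B : Fin M → Torus.energySpace (Fin 3)) :
    IsProbabilityMeasure (ENNReal.ofReal a • μ₁ +
      ∑ l, ENNReal.ofReal (q l) • (Measure.dirac (A l) + Measure.dirac (B l))) := by
  refine ⟨?_⟩
  simp only [Measure.add_apply, Measure.smul_apply, Measure.coe_finsetSum, Finset.sum_apply,
    measure_univ, smul_eq_mul, mul_one]
  have h2 : ∀ l, ENNReal.ofReal (q l) * (1 + 1) = ENNReal.ofReal (2 * q l) := fun l => by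
    rw [one_add_one_eq_two, ← ENNReal.ofReal_ofNat 2, ← ENNReal.ofReal_mul (hq l), mul_comm]
  simp_rw [h2]
  rw [← ENNReal.ofReal_sum_of_nonneg (fun l _ => by linarith [hq l]),
    ← ENNReal.ofReal_add ha (Finset.sum_nonneg fun l _ => by linarith [hq l]), hsum,
    ENNReal.ofReal_one]

/-- Integrability against the composite law follows from integrability against `μ₁`
(every observable is integrable against a Dirac mass). [folklore] -/
theorem integrable_composite {M : ℕ} {μ₁ : Measure (Torus.energySpace (Fin 3))} {a : ℝ}
    {q : Fin M → ℝ} {A B : Fin M → Torus.energySpace (Fin 3)}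
    {F : Torus.energySpace (Fin 3) → ℝ} (hF : Integrable F μ₁) :
    Integrable F (ENNReal.ofReal a • μ₁ +
      ∑ l, ENNReal.ofReal (q l) • (Measure.dirac (A l) + Measure.dirac (B l))) :=
  (hF.smul_measure ENNReal.ofReal_ne_top).add_measure (integrable_finsetSum_measure.2 fun l _ =>
    ((Torus.integrable_dirac (A l) F).add_measure (Torus.integrable_dirac (B l) F)).smul_measure
      ENNReal.ofReal_ne_top)

/-- **Integration against the composite law**:
`∫ F d(a μ₁ + Σₗ qₗ (δ_{Aₗ} + δ_{Bₗ})) = a ∫ F dμ₁ + Σₗ qₗ (F(Aₗ) + F(Bₗ))`. [folklore] -/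
theorem integral_composite {M : ℕ} {μ₁ : Measure (Torus.energySpace (Fin 3))} {a : ℝ}
    {q : Fin M → ℝ} (ha : 0 ≤ a) (hq : ∀ l, 0 ≤ q l) (A B : Fin M → Torus.energySpace (Fin 3))
    {F : Torus.energySpace (Fin 3) → ℝ} (hF : Integrable F μ₁) :
    ∫ u, F u ∂(ENNReal.ofReal a • μ₁ +
      ∑ l, ENNReal.ofReal (q l) • (Measure.dirac (A l) + Measure.dirac (B l))) =
      a * ∫ u, F u ∂μ₁ + ∑ l, q l * (F (A l) + F (B l)) := by
  haveI : MeasurableSingletonClass (Torus.energySpace (Fin 3)) :=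
    OpensMeasurableSpace.toMeasurableSingletonClass
  have h1 : Integrable F (ENNReal.ofReal a • μ₁) := hF.smul_measure ENNReal.ofReal_ne_top
  have hD : ∀ l, Integrable F (Measure.dirac (A l) + Measure.dirac (B l)) := fun l =>
    (Torus.integrable_dirac _ F).add_measure (Torus.integrable_dirac _ F)
  have h2 : ∀ l ∈ Finset.univ, Integrable F
      (ENNReal.ofReal (q l) • (Measure.dirac (A l) + Measure.dirac (B l))) := fun l _ =>
    (hD l).smul_measure ENNReal.ofReal_ne_top
  rw [integral_add_measure h1 (integrable_finsetSum_measure.2 h2), integral_smul_measure,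
    integral_finsetSum_measure h2, ENNReal.toReal_ofReal ha, smul_eq_mul]
  congr 1
  refine Finset.sum_congr rfl fun l _ => ?_
  rw [integral_smul_measure, integral_add_measure (Torus.integrable_dirac _ F)
    (Torus.integrable_dirac _ F), integral_dirac, integral_dirac, ENNReal.toReal_ofReal (hq l),
    smul_eq_mul]

/-! ## Rows: additivity in the polynomial, integrability on level-`N`-carried laws -/

/-- **The row is additive in the polynomial**: `row_P = row_{P'} + row_{P − P'}` pointwise. [folklore] -/
theorem row_eq_add_of_sub (ν : ℝ) {f : UnitAddTorus (Fin 3) → EuclideanSpace ℝ (Fin 3)}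
    (hf : Integrable f volume) {m : ℕ} {g : Fin m → UnitAddTorus (Fin 3) → EuclideanSpace ℝ (Fin 3)}
    (hg : ∀ i, Torus.IsSmooth (g i)) (P P' : MvPolynomial (Fin m) ℝ)
    (u : Torus.energySpace (Fin 3)) :
    Torus.nsGeneratorPairing ν f u (fun x => ∑ i,
        (MvPolynomial.eval (fun j => Torus.pairing u.1 (g j)) (MvPolynomial.pderiv i P)) • g i x) =
      Torus.nsGeneratorPairing ν f u (fun x => ∑ i,
        (MvPolynomial.eval (fun j => Torus.pairing u.1 (g j)) (MvPolynomial.pderiv i P')) • g i x) +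
      Torus.nsGeneratorPairing ν f u (fun x => ∑ i,
        (MvPolynomial.eval (fun j => Torus.pairing u.1 (g j))
          (MvPolynomial.pderiv i (P - P'))) • g i x) := by
  rw [Torus.nsGeneratorPairing_sum_smul ν hf u Finset.univ _ fun i _ => hg i,
    Torus.nsGeneratorPairing_sum_smul ν hf u Finset.univ _ fun i _ => hg i,
    Torus.nsGeneratorPairing_sum_smul ν hf u Finset.univ _ fun i _ => hg i, ← Finset.sum_add_distrib]
  refine Finset.sum_congr rfl fun i _ => ?_
  rw [← add_mul, ← map_add, ← map_add, add_sub_cancel]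

/-- **An observable which is a coordinate polynomial of degree `≤ 4` on level-`N` fields is
integrable** against a finite level-`N`-carried law with `∫ ‖u‖⁴ < ∞`, and its integral is that of
the polynomial. [folklore] -/
theorem integrable_of_eval_of_level
    (hb : ∀ i, Torus.IsSmooth (b i) ∧ Torus.IsDivFree (b i) ∧ Torus.HasZeroMean (b i) ∧
      ∀ k ∉ (Torus.freqBall N).erase (0 : Fin 3 → ℤ),
        UnitAddTorus.mFourierCoeff (EuclideanSpace.complexify ∘ (b i)) k = 0)
    (hbo : ∀ i j, ∫ x, ⟪b i x, b j x⟫_ℝ = if i = j then (1 : ℝ) else 0)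
    {μ : Measure (Torus.energySpace (Fin 3))} [IsFiniteMeasure μ]
    (hlev : ∀ᵐ u ∂μ, ∀ k ∉ (Torus.freqBall N).erase (0 : Fin 3 → ℤ),
      UnitAddTorus.mFourierCoeff (EuclideanSpace.complexify ∘
        (u.1 : UnitAddTorus (Fin 3) → EuclideanSpace ℝ (Fin 3))) k = 0)
    (h4 : Integrable (fun u : Torus.energySpace (Fin 3) => ‖u‖ ^ 4) μ)
    {F : Torus.energySpace (Fin 3) → ℝ} {Q : MvPolynomial (Fin n) ℝ} (hQ : Q.totalDegree ≤ 4)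
    (hFQ : ∀ u : Torus.energySpace (Fin 3), (∀ k ∉ (Torus.freqBall N).erase (0 : Fin 3 → ℤ),
        UnitAddTorus.mFourierCoeff (EuclideanSpace.complexify ∘
          (u.1 : UnitAddTorus (Fin 3) → EuclideanSpace ℝ (Fin 3))) k = 0) →
      F u = MvPolynomial.eval (fun i => Torus.pairing u.1 (b i)) Q) :
    Integrable F μ ∧ ∫ u, F u ∂μ = ∫ u, MvPolynomial.eval (fun i => Torus.pairing u.1 (b i)) Q ∂μ := by
  have hae : F =ᵐ[μ] fun u => MvPolynomial.eval (fun i => Torus.pairing u.1 (b i)) Q :=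
    hlev.mono fun u hu => hFQ u hu
  exact ⟨(integrable_eval_coords_of_four hb hbo h4 Q hQ).1.congr hae.symm, integral_congr_ae hae⟩

end Summit.AnomalousDissipation.AnomalousDissipation.Theorems.MomentParityQuarticGate
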